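import Literature.MathematicalPhysics.QuantumFieldTheory.Balaban1983to89.B12Lemma4Concrete
import Literature.MathematicalPhysics.QuantumFieldTheory.Balaban1983to89.B12Eq18Current

/-!
# `Balaban1983to89.B12Lemma4Space` — T. Bałaban, *Renormalization group approach to lattice gauge field theories. I*,
Commun. Math. Phys. **109** (1987) 249–301 [Balaban1987RG1]: **Lemma 4 (3.53) p. 280 / (3.36) p. 277 on the CONCRETE space
`U^c_j(X, α₀, α₁)` of `B12RegularSpaces111` — PART 2 (the assembly)**: the pair `(exp iξ(𝐇_j(□₀, τQ(L⁻¹η𝐇_{k+1})) + 𝐀₂), 𝐉)`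
satisfies conditions (i)–(iii) of the space (`SatisfiesI_III`) from the printed bond-level inputs (3.37), (3.41), (3.45), (3.50)
under «all the restrictions» (`B12Sec2to5.Lemma4Restrictions` + the three unlisted constant hypotheses of `B12ExpSteps`), and —
given condition (iv), which the print takes «from the corresponding identity (3.38)» (data-level) — lies in `space′ 𝓜 F c α₀ α₁`.
PART 1 = the sibling `B12Lemma4Concrete` (plaquette reading `plaq_expI_eq_holonomy`, the mechanism `U = 1`, `A′ = 𝐊` of (i)/(ii),
the two half-budgets of (ii), (iii) on the lattice from `B12Plaquette343.condIII_first_plaquette_shifted`); the J-half («The second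
is proved in the same way, as it was already discussed», p. 280) enters either as the hypothesis `|𝐉| < α₀` on `X` or through the
J-budget of `B12CondIIIJ.condIII_second_of_restrictions`.  Carriers of record only; nothing re-declared.

HONEST FRAMING (cell `lit-balaban`, verbatim): statement-level skeleton of published theorems with citation tags; proofs where landed; nothing here is a claim about the Yang–Mills mass gap.

PDF held: `paper:balaban1987-cmp109-rg-i-small-field` (journal page = PDF page + 248); pp. 277–280 re-read as images from the
renders `b2b-balaban-ref1/pages/1987-cmp109-rg-I-small-field/1987-cmp109-rg-I-small-field-p029…p032-x2.png` by this unit.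

THE PRINT, verbatim (p. 280): *«where the last equality is a definition of 𝐀₂. It implies |𝐀₂|, |∇^ξ𝐀₂| ≦ B₃|B′| < B₃α₃, and if
B₃α₃ < 1/2α₁, then this and the inequality in (3.37) imply the conditions (i), (ii).»* … *«|∂ exp iξ𝐇_j(□₀, τQ(L⁻¹η𝐇_{k+1}) + B′)
− 1| < (1+8β)L⁻²α₀ξ² on □̃³. (3.52) This implies the first inequality in the condition (iii). The second is proved in the same way,
as it was already discussed. The condition (iv) follows from the corresponding identity (3.38). Thus we have proved (3.36) in several
versions. Let us formulate the one which will be used to bound the terms in (3.34).  **Lemma 4.** For 𝐔 ∈ U′ᶜ_{k+1}(□₀, (1+2β)α₀,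
(1+2β)α₁), 𝐀 defined on □₀ and satisfying (3.31), B′ defined on the set of bonds connected with the definition of U_j(□₀, ·) and
satisfying |B′| < α₃, we have (U_j(□₀, exp i(τB + B′)), J_j(□₀, exp i(τB + B′)))|_X ∈ U^c_j(X, α₀, α₁) (3.53) for α₀, α₁, α₂, α₃
sufficiently small and satisfying all the restrictions. The functions in (3.53) are analytic on the above spaces.»*  (pp. 277–279 as
quoted in the header of `B12Lemma4Concrete`; U_j(□₀, ·) = (exp iξ𝐇_j(□₀, ·))^{u_j} by (3.37), and the `Gᶜ`-valued gauge transformation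
only moves the pair inside its orbit, `B12RegularSpaces111.act_mem_space_iff`, so membership is decided on `exp iξ𝐇_j` itself.)

THE HYPOTHESES (all by-reference inputs of the print, exactly those of `B12Plaquette343` + `B12CondIIIJ`, now as bond/plaquette data on
the lattice of `Setup`): constants `c` with `Lemma4Restrictions c`, `B₃ ≥ 1`, `B₃²O(1)M ≥ 1`, `16·O(1)Mα₁ ≤ β`; step constants `cs` of the
space (`ξ = cs.ξ ∈ (0, 1]`, `ξ·L^{j−1}η = L⁻¹η` i.e. `ξ = L^{−j}`, `O(1)LMB > 0`); `1 ≤ j`, `L^jη ≤ 1` («j ≤ k, hence L^jη ≤ 1»);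
`τ ∈ [0, 1]`; `n = |B′| < α₃`; a region `Y` (= □̃³ ⊇ X: p. 277 «on the cube □̃³, hence on X») containing the bonds and derivative pairs
of `X` and the four bonds / two derivative pairs of each plaquette of `X`; bond data on `Y`: `𝐇 = 𝐇_j(□₀, Q(…))`, `𝐊 = 𝐇_j(□₀, τQ(…))`
with (3.37) (values and `∇^ξ`), `𝐀 = 𝐀₂` with (3.50); plaquette data on `X`: the literal first inequality of (3.41), (3.45) at `Q` and
at `τQ` against the linear part `ℓ(p) = (∂^ξH_{1,j}Q(…))(p)`; values: `𝐊`, `𝐀`, `𝐉` `𝔤ᶜ`-valued on `X`, `exp iξ·` maps `𝔤ᶜ` into `Gᶜ`.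
WHAT IS PROVED: `satisfiesI_III_lemma4` ((i)–(iii) with B′), `satisfiesI_III_eq336` (B′ = 0: (3.36) proper),
`satisfiesI_III_lemma4_of_jBudget` (J-half discharged from the `B12CondIIIJ` budget + its one unlisted restriction `B₃″α₃ ≤ βL⁻²α₀`),
`mem_space'_lemma4` (membership, given (iv) for `𝐔` and for `U = 1`), and the same for THE PRINTED PAIR of p. 278 «exp iξ𝐇_j(…),
D^{ξ*}_{exp iξ𝐇_j(…)}ξ⁻²π Im ∂ exp iξ𝐇_j(…)» = `B12Eq18Current.ofBackground π ξ (exp iξ(𝐊 + 𝐀₂))` (the substitution (1.9) with the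
concrete current (1.8); its `𝔤ᶜ`-valuedness from `B12Eq18Current.current_mem_gc`): `ofBackground_satisfiesI_III_lemma4`,
`ofBackground_mem_space'_lemma4`.  NOT here: the functions `𝐇_j`, `H_{1,j}`, `𝐀₂`, `u_j` of
[Balaban1985Variational] and their bounds (hypotheses), the current itself (`B12Eq18Current.current`; any `𝔤ᶜ`-valued `𝐉` with its
bound — for the printed pair: the bound (3.42)-ladder on `B12Eq18Current.current`, hypothesis), condition (iv) (hypothesis), analyticity
(not modelled).  No `def`, no `Prop` placeholder, no new fact; axioms standard.
Unit `lit-balaban-p07` (Phase-2 seat p07 gen 6; TAKING line HOME/STATUS.md 2026-08-21T06:32:00Z; rows B12.Lem4 / B12.Eq3.36, owners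
r09/r20), HOME `run/shared/lean/pub/lit-balaban/`.
-/

namespace Literature.MathematicalPhysics.QuantumFieldTheory.Balaban1983to89.B12Lemma4Space

open Literature.MathematicalPhysics.QuantumFieldTheory.Balaban1983to89
open Literature.MathematicalPhysics.QuantumFieldTheory.Balaban1983to89.B12RegularSpaces111
open Literature.MathematicalPhysics.QuantumFieldTheory.Balaban1983to89.B12RegularSpaces111Mono
open Literature.MathematicalPhysics.QuantumFieldTheory.Balaban1983to89.B12Lemma4Concrete
open Complex (I)

noncomputable section

variable {P : Params} {i : ℕ} {𝔸 : Type*} [NormedRing 𝔸] [NormedAlgebra ℂ 𝔸] [CompleteSpace 𝔸]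

/-! ## Lemma 4 / (3.36) on the concrete space `U^c_j(X, α₀, α₁)` -/

variable (𝓜 : Model 𝔸)

/-- The scaling gain used by both halves of (ii): `x = L^{j−1}η ≤ L⁻¹ ≤ 1` («j ≤ k, hence L^jη ≤ 1», `L > 1`). [folklore] -/
private theorem scale_le_one {L η : ℝ} {j : ℕ} (hL1 : 1 < L) (hη : 0 ≤ η) (hj : 1 ≤ j) (hscale : L ^ j * η ≤ 1) :
    L ^ (j - 1) * η ≤ 1 :=
  (B12CondIIIJ.scale_le (by linarith) hη hj hscale).trans (inv_le_one_of_one_le₀ hL1.le)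

/-- **Lemma 4 (3.53) / (3.36) with B′, conditions (i)–(iii) of the CONCRETE space.**  Constants `c` under `Lemma4Restrictions c`
(«all the restrictions») + the three unlisted constant hypotheses of `B12ExpSteps`; the step constants `cs` of the space with
`ξ = cs.ξ ∈ (0, 1]`, `ξ·L^{j−1}η = L⁻¹η` (`ξ = L^{−j}`), `O(1)LMB > 0`; `1 ≤ j`, `L^jη ≤ 1`; `τ ∈ [0, 1]`; `|B′| = n < α₃`.  Bond data on a
region `Y` (= □̃³) containing the bonds and derivative pairs of `X` and of its plaquettes: `𝐇 = 𝐇_j(□₀, Q(L⁻¹η𝐇_{k+1}))` and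
`𝐊 = 𝐇_j(□₀, τQ(…))` with (3.37), `𝐀 = 𝐀₂` with (3.50), all `𝔤ᶜ`-valued on `X`; plaquette data on `X`: the literal first inequality of
(3.41) and (3.45) at `Q`, `τQ` against the linear part `ℓ`; the J-half `|𝐉| < α₀` on `X` («The second is proved in the same way, as it
was already discussed» — by reference; see `satisfiesI_III_lemma4_of_jBudget` for the `B12CondIIIJ` discharge) with `𝐉` `𝔤ᶜ`-valued;
`exp iξ·` maps `𝔤ᶜ` into `Gᶜ`.  CONCLUSION: the pair `(exp iξ(𝐊 + 𝐀), 𝐉)` satisfies (i)–(iii) of `U^c_j(X, α₀, α₁)` (`γ₀ = α₀`), with the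
factorisation `U = 1`, `A′ = 𝐊 + 𝐀` — (i) `condI_one`; (ii) §3; (iii) §4 + the hypothesis. [cite: Balaban1987RG1, Lemma 4 (3.53) p.280] -/
theorem satisfiesI_III_lemma4 (c : B12Sec2to5.Lemma4Consts) (hR : B12Sec2to5.Lemma4Restrictions c)
    (hB : 1 ≤ c.B₃) (hY : 1 ≤ c.B₃ ^ 2 * c.O₁ * c.M) (hα₁ : 16 * (c.O₁ * c.M * c.α₁) ≤ c.β)
    {F : Frame P i 𝔸} {cs : StepConsts} (hξ : 0 < cs.ξ) (hξ1 : cs.ξ ≤ 1) (hcB : 0 < cs.cB)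
    {η τ n : ℝ} {j : ℕ} (hη : 0 ≤ η) (hj : 1 ≤ j) (hscale : c.L ^ j * η ≤ 1)
    (hξx : cs.ξ * (c.L ^ (j - 1) * η) = c.L⁻¹ * η) (hτ0 : 0 ≤ τ) (hτ1 : τ ≤ 1) (hn : n < c.α₃)
    (heGc : ∀ A ∈ 𝓜.gc, expI cs.ξ A ∈ 𝓜.Gc)
    {Y : Region P i} (hXb : F.X.bonds ⊆ Y.bonds) (hXd : F.X.dpairs ⊆ Y.dpairs)
    (hXp : ∀ p ∈ F.X.plaqs, (⟨p.src, p.μ⟩ : PBond P i) ∈ Y.bonds ∧ (⟨p.src.shift p.μ, p.ν⟩ : PBond P i) ∈ Y.bonds ∧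
      (⟨p.src.shift p.ν, p.μ⟩ : PBond P i) ∈ Y.bonds ∧ (⟨p.src, p.ν⟩ : PBond P i) ∈ Y.bonds ∧
      (p.src, p.μ, p.ν) ∈ Y.dpairs ∧ (p.src, p.ν, p.μ) ∈ Y.dpairs)
    {H K A J : PBond P i → 𝔸} {ℓ : Plaq P i → 𝔸}
    (hKgc : ∀ b ∈ F.X.bonds, K b ∈ 𝓜.gc) (hAgc : ∀ b ∈ F.X.bonds, A b ∈ 𝓜.gc) (hJgc : ∀ b ∈ F.X.bonds, J b ∈ 𝓜.gc)
    (h41 : ∀ p ∈ F.X.plaqs, ‖((plaq (fun b => expI cs.ξ (H b)) p : 𝔸ˣ) : 𝔸) - 1‖ <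
      Real.exp (c.B₃ ^ 2 * c.O₁ * c.M * c.α₀) * Real.exp (c.B₃ * c.O₁ * c.M * c.α₀) *
      Real.exp (c.B₃ * c.O₁ * c.M * c.α₀) * Real.exp (c.O₁ * c.M * c.α₁) *
      ((1 + 2 * c.β) * c.α₀ * (c.L⁻¹ * η) ^ 2))
    (hH : ∀ b ∈ Y.bonds, ‖H b‖ < c.B₃ ^ 2 * c.O₁ * c.M * c.α₀ * (c.L ^ (j - 1) * η))
    (h45 : ∀ p ∈ F.X.plaqs, ‖(cs.ξ : ℂ)⁻¹ • (H ⟨p.src, p.μ⟩ + H ⟨p.src.shift p.μ, p.ν⟩ - H ⟨p.src.shift p.ν, p.μ⟩ -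
      H ⟨p.src, p.ν⟩) - ℓ p‖ < c.B₃ * (c.B₃ * c.O₁ * c.M * c.α₀ * (c.L ^ (j - 1) * η)) ^ 2)
    (hK : ∀ b ∈ Y.bonds, ‖K b‖ < c.B₃ ^ 2 * c.O₁ * c.M * c.α₀ * (c.L ^ (j - 1) * η))
    (hK1 : ∀ q ∈ Y.dpairs, ‖grad cs.ξ q.2.1 (fun y => K ⟨y, q.2.2⟩) q.1‖ < c.B₃ ^ 2 * c.O₁ * c.M * c.α₀ * (c.L ^ (j - 1) * η))
    (h45τ : ∀ p ∈ F.X.plaqs, ‖(cs.ξ : ℂ)⁻¹ • (K ⟨p.src, p.μ⟩ + K ⟨p.src.shift p.μ, p.ν⟩ - K ⟨p.src.shift p.ν, p.μ⟩ -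
      K ⟨p.src, p.ν⟩) - (τ : ℂ) • ℓ p‖ < c.B₃ * (c.B₃ * c.O₁ * c.M * c.α₀ * (c.L ^ (j - 1) * η)) ^ 2)
    (hA : ∀ b ∈ Y.bonds, ‖A b‖ ≤ c.B₃ * n)
    (hdA : ∀ q ∈ Y.dpairs, ‖grad cs.ξ q.2.1 (fun y => A ⟨y, q.2.2⟩) q.1‖ ≤ c.B₃ * n)
    (hJ : ∀ b ∈ F.X.bonds, ‖J b‖ < c.α₀) :
    SatisfiesI_III 𝓜 F cs c.α₀ c.α₁ c.α₀ ⟨fun b => expI cs.ξ (K b + A b), J⟩ := by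
  have hR' := hR
  unfold B12Sec2to5.Lemma4Restrictions at hR'
  obtain ⟨hα₀, _, _, _, _, _, _, hL1, hres9, _, _, hres12, _, _⟩ := hR'
  have hB0 : 0 ≤ c.B₃ := by linarith
  have hY0 : 0 ≤ c.B₃ ^ 2 * c.O₁ * c.M * c.α₀ := by nlinarith
  have hx1 := scale_le_one hL1 hη hj hscale
  refine satisfiesI_III_expI 𝓜 hξ hcB hα₀ heGc (fun b hb => 𝓜.gc.add_mem (hKgc b hb) (hAgc b hb)) hJgc
    (fun b hb => ?_) (fun q hq => ?_) ?_ hJ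
  · exact norm_add_lt_alpha1 hx1 hB0 hY0 hres9 hres12 (hK b (hXb hb)) hn (hA b (hXb hb))
  · exact norm_grad_add_lt_alpha1 cs.ξ q.2.1 q.1 hx1 hB0 hY0 hres9 hres12 (hK1 q (hXd hq)) hn (hdA q (hXd hq))
  · exact condIII_first_region c hR hB hY hα₁ hη hj hscale hξ hξ1 hξx hτ0 hτ1 hn hXp h41 hH h45 hK h45τ hA hdA

/-- **(3.36) proper (B′ = 0, `𝐀₂ = 0`)**: «(U_j(□₀, exp iτB), J_j(□₀, exp iτB))|_X ∈ U^c_j(X, α₀, α₁) (3.36) … for the parameters τ in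
the interval [0, 1]» at `𝐀 = 0` — the pair `(exp iξ𝐇_j(□₀, τQ(L⁻¹η𝐇_{k+1})), 𝐉)` satisfies (i)–(iii) of `U^c_j(X, α₀, α₁)` from (3.37),
(3.41), (3.45) and the J-half. [cite: Balaban1987RG1, (3.36) p.277] -/
theorem satisfiesI_III_eq336 (c : B12Sec2to5.Lemma4Consts) (hR : B12Sec2to5.Lemma4Restrictions c)
    (hB : 1 ≤ c.B₃) (hY : 1 ≤ c.B₃ ^ 2 * c.O₁ * c.M) (hα₁ : 16 * (c.O₁ * c.M * c.α₁) ≤ c.β)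
    {F : Frame P i 𝔸} {cs : StepConsts} (hξ : 0 < cs.ξ) (hξ1 : cs.ξ ≤ 1) (hcB : 0 < cs.cB)
    {η τ : ℝ} {j : ℕ} (hη : 0 ≤ η) (hj : 1 ≤ j) (hscale : c.L ^ j * η ≤ 1)
    (hξx : cs.ξ * (c.L ^ (j - 1) * η) = c.L⁻¹ * η) (hτ0 : 0 ≤ τ) (hτ1 : τ ≤ 1)
    (heGc : ∀ A ∈ 𝓜.gc, expI cs.ξ A ∈ 𝓜.Gc)
    {Y : Region P i} (hXb : F.X.bonds ⊆ Y.bonds) (hXd : F.X.dpairs ⊆ Y.dpairs)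
    (hXp : ∀ p ∈ F.X.plaqs, (⟨p.src, p.μ⟩ : PBond P i) ∈ Y.bonds ∧ (⟨p.src.shift p.μ, p.ν⟩ : PBond P i) ∈ Y.bonds ∧
      (⟨p.src.shift p.ν, p.μ⟩ : PBond P i) ∈ Y.bonds ∧ (⟨p.src, p.ν⟩ : PBond P i) ∈ Y.bonds ∧
      (p.src, p.μ, p.ν) ∈ Y.dpairs ∧ (p.src, p.ν, p.μ) ∈ Y.dpairs)
    {H K J : PBond P i → 𝔸} {ℓ : Plaq P i → 𝔸}
    (hKgc : ∀ b ∈ F.X.bonds, K b ∈ 𝓜.gc) (hJgc : ∀ b ∈ F.X.bonds, J b ∈ 𝓜.gc)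
    (h41 : ∀ p ∈ F.X.plaqs, ‖((plaq (fun b => expI cs.ξ (H b)) p : 𝔸ˣ) : 𝔸) - 1‖ <
      Real.exp (c.B₃ ^ 2 * c.O₁ * c.M * c.α₀) * Real.exp (c.B₃ * c.O₁ * c.M * c.α₀) *
      Real.exp (c.B₃ * c.O₁ * c.M * c.α₀) * Real.exp (c.O₁ * c.M * c.α₁) *
      ((1 + 2 * c.β) * c.α₀ * (c.L⁻¹ * η) ^ 2))
    (hH : ∀ b ∈ Y.bonds, ‖H b‖ < c.B₃ ^ 2 * c.O₁ * c.M * c.α₀ * (c.L ^ (j - 1) * η))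
    (h45 : ∀ p ∈ F.X.plaqs, ‖(cs.ξ : ℂ)⁻¹ • (H ⟨p.src, p.μ⟩ + H ⟨p.src.shift p.μ, p.ν⟩ - H ⟨p.src.shift p.ν, p.μ⟩ -
      H ⟨p.src, p.ν⟩) - ℓ p‖ < c.B₃ * (c.B₃ * c.O₁ * c.M * c.α₀ * (c.L ^ (j - 1) * η)) ^ 2)
    (hK : ∀ b ∈ Y.bonds, ‖K b‖ < c.B₃ ^ 2 * c.O₁ * c.M * c.α₀ * (c.L ^ (j - 1) * η))
    (hK1 : ∀ q ∈ Y.dpairs, ‖grad cs.ξ q.2.1 (fun y => K ⟨y, q.2.2⟩) q.1‖ < c.B₃ ^ 2 * c.O₁ * c.M * c.α₀ * (c.L ^ (j - 1) * η))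
    (h45τ : ∀ p ∈ F.X.plaqs, ‖(cs.ξ : ℂ)⁻¹ • (K ⟨p.src, p.μ⟩ + K ⟨p.src.shift p.μ, p.ν⟩ - K ⟨p.src.shift p.ν, p.μ⟩ -
      K ⟨p.src, p.ν⟩) - (τ : ℂ) • ℓ p‖ < c.B₃ * (c.B₃ * c.O₁ * c.M * c.α₀ * (c.L ^ (j - 1) * η)) ^ 2)
    (hJ : ∀ b ∈ F.X.bonds, ‖J b‖ < c.α₀) :
    SatisfiesI_III 𝓜 F cs c.α₀ c.α₁ c.α₀ ⟨fun b => expI cs.ξ (K b), J⟩ := by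
  have hα₃ : (0 : ℝ) < c.α₃ := by
    have hR' := hR
    unfold B12Sec2to5.Lemma4Restrictions at hR'
    exact hR'.2.2.2.1
  have e : (fun b => expI cs.ξ (K b + (0 : PBond P i → 𝔸) b)) = fun b => expI cs.ξ (K b) := by
    funext b
    rw [Pi.zero_apply, add_zero]
  rw [← e]
  refine satisfiesI_III_lemma4 𝓜 c hR hB hY hα₁ hξ hξ1 hcB hη hj hscale hξx hτ0 hτ1 hα₃ heGc hXb hXd hXp hKgc
    (fun b _ => 𝓜.gc.zero_mem) hJgc h41 hH h45 hK hK1 h45τ (fun b _ => ?_) (fun q _ => ?_) hJ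
  · rw [Pi.zero_apply, norm_zero, mul_zero]
  · simp only [Pi.zero_apply, grad, sub_self, smul_zero, norm_zero, mul_zero, le_refl]

/-- **Lemma 4 with the J-half DISCHARGED from the J-budget of `B12CondIIIJ`**: as `satisfiesI_III_lemma4`, but instead of `|𝐉| < α₀` the
hypothesis is the J-budget bound delivered by `B12CondIIIJ.jLadder_bound` at `x = L^{j−1}η` (the ladder «we start with (3.42) and we use
again the formulas and the bounds (1.43)–(1.54) [14]» with its inputs explicit there), plus the one unlisted restriction `B₃″α₃ ≤ βL⁻²α₀`
on the second-derivative constant; `B12CondIIIJ.condIII_second_of_restrictions` closes `|𝐉| < α₀`.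
[cite: Balaban1987RG1, Lemma 4 (3.53) p.280] -/
theorem satisfiesI_III_lemma4_of_jBudget (c : B12Sec2to5.Lemma4Consts) (hR : B12Sec2to5.Lemma4Restrictions c)
    (hB : 1 ≤ c.B₃) (hY : 1 ≤ c.B₃ ^ 2 * c.O₁ * c.M) (hα₁ : 16 * (c.O₁ * c.M * c.α₁) ≤ c.β)
    {F : Frame P i 𝔸} {cs : StepConsts} (hξ : 0 < cs.ξ) (hξ1 : cs.ξ ≤ 1) (hcB : 0 < cs.cB)
    {η τ n B₃'' : ℝ} {j : ℕ} (hη : 0 ≤ η) (hj : 1 ≤ j) (hscale : c.L ^ j * η ≤ 1)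
    (hξx : cs.ξ * (c.L ^ (j - 1) * η) = c.L⁻¹ * η) (hτ0 : 0 ≤ τ) (hτ1 : τ ≤ 1) (hn : n < c.α₃)
    (hres'' : B₃'' * c.α₃ ≤ c.β * c.L⁻¹ ^ 2 * c.α₀)
    (heGc : ∀ A ∈ 𝓜.gc, expI cs.ξ A ∈ 𝓜.Gc)
    {Y : Region P i} (hXb : F.X.bonds ⊆ Y.bonds) (hXd : F.X.dpairs ⊆ Y.dpairs)
    (hXp : ∀ p ∈ F.X.plaqs, (⟨p.src, p.μ⟩ : PBond P i) ∈ Y.bonds ∧ (⟨p.src.shift p.μ, p.ν⟩ : PBond P i) ∈ Y.bonds ∧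
      (⟨p.src.shift p.ν, p.μ⟩ : PBond P i) ∈ Y.bonds ∧ (⟨p.src, p.ν⟩ : PBond P i) ∈ Y.bonds ∧
      (p.src, p.μ, p.ν) ∈ Y.dpairs ∧ (p.src, p.ν, p.μ) ∈ Y.dpairs)
    {H K A J : PBond P i → 𝔸} {ℓ : Plaq P i → 𝔸}
    (hKgc : ∀ b ∈ F.X.bonds, K b ∈ 𝓜.gc) (hAgc : ∀ b ∈ F.X.bonds, A b ∈ 𝓜.gc) (hJgc : ∀ b ∈ F.X.bonds, J b ∈ 𝓜.gc)
    (h41 : ∀ p ∈ F.X.plaqs, ‖((plaq (fun b => expI cs.ξ (H b)) p : 𝔸ˣ) : 𝔸) - 1‖ <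
      Real.exp (c.B₃ ^ 2 * c.O₁ * c.M * c.α₀) * Real.exp (c.B₃ * c.O₁ * c.M * c.α₀) *
      Real.exp (c.B₃ * c.O₁ * c.M * c.α₀) * Real.exp (c.O₁ * c.M * c.α₁) *
      ((1 + 2 * c.β) * c.α₀ * (c.L⁻¹ * η) ^ 2))
    (hH : ∀ b ∈ Y.bonds, ‖H b‖ < c.B₃ ^ 2 * c.O₁ * c.M * c.α₀ * (c.L ^ (j - 1) * η))
    (h45 : ∀ p ∈ F.X.plaqs, ‖(cs.ξ : ℂ)⁻¹ • (H ⟨p.src, p.μ⟩ + H ⟨p.src.shift p.μ, p.ν⟩ - H ⟨p.src.shift p.ν, p.μ⟩ -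
      H ⟨p.src, p.ν⟩) - ℓ p‖ < c.B₃ * (c.B₃ * c.O₁ * c.M * c.α₀ * (c.L ^ (j - 1) * η)) ^ 2)
    (hK : ∀ b ∈ Y.bonds, ‖K b‖ < c.B₃ ^ 2 * c.O₁ * c.M * c.α₀ * (c.L ^ (j - 1) * η))
    (hK1 : ∀ q ∈ Y.dpairs, ‖grad cs.ξ q.2.1 (fun y => K ⟨y, q.2.2⟩) q.1‖ < c.B₃ ^ 2 * c.O₁ * c.M * c.α₀ * (c.L ^ (j - 1) * η))
    (h45τ : ∀ p ∈ F.X.plaqs, ‖(cs.ξ : ℂ)⁻¹ • (K ⟨p.src, p.μ⟩ + K ⟨p.src.shift p.μ, p.ν⟩ - K ⟨p.src.shift p.ν, p.μ⟩ -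
      K ⟨p.src, p.ν⟩) - (τ : ℂ) • ℓ p‖ < c.B₃ * (c.B₃ * c.O₁ * c.M * c.α₀ * (c.L ^ (j - 1) * η)) ^ 2)
    (hA : ∀ b ∈ Y.bonds, ‖A b‖ ≤ c.B₃ * n)
    (hdA : ∀ q ∈ Y.dpairs, ‖grad cs.ξ q.2.1 (fun y => A ⟨y, q.2.2⟩) q.1‖ ≤ c.B₃ * n)
    (hJ : ∀ b ∈ F.X.bonds, ‖J b‖ < (1 + 3 * c.β) * c.α₀ * (c.L ^ (j - 1) * η) ^ 3 + 3 * c.β * c.α₀ * (c.L ^ (j - 1) * η) ^ 2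
      + B₃'' * c.α₃ + c.β * c.L⁻¹ ^ 2 * c.α₀) :
    SatisfiesI_III 𝓜 F cs c.α₀ c.α₁ c.α₀ ⟨fun b => expI cs.ξ (K b + A b), J⟩ :=
  satisfiesI_III_lemma4 𝓜 c hR hB hY hα₁ hξ hξ1 hcB hη hj hscale hξx hτ0 hτ1 hn heGc hXb hXd hXp hKgc hAgc hJgc h41 hH h45
    hK hK1 h45τ hA hdA fun b hb => B12CondIIIJ.condIII_second_of_restrictions c hR hη hj hscale hres'' (hJ b hb)

/-- **Lemma 4, membership in the concrete space**: under the hypotheses of `satisfiesI_III_lemma4` and condition (iv) (1.16) for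
`𝐔 = exp iξ(𝐊 + 𝐀₂)` and for `U = 1` («The condition (iv) follows from the corresponding identity (3.38)» — the functions of (1.15) are
`Frame.bg` data), `(exp iξ(𝐊 + 𝐀₂), 𝐉) ∈ U^c_j(X, α₀, α₁)` = `space′ 𝓜 F cs α₀ α₁`; the gauge transformation `u_j` of (3.37)/(3.38) then
keeps the orbit inside (`B12RegularSpaces111.act_mem_space_iff`). [cite: Balaban1987RG1, Lemma 4 (3.53) p.280] -/
theorem mem_space'_lemma4 (c : B12Sec2to5.Lemma4Consts) (hR : B12Sec2to5.Lemma4Restrictions c)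
    (hB : 1 ≤ c.B₃) (hY : 1 ≤ c.B₃ ^ 2 * c.O₁ * c.M) (hα₁ : 16 * (c.O₁ * c.M * c.α₁) ≤ c.β)
    {F : Frame P i 𝔸} {cs : StepConsts} (hξ : 0 < cs.ξ) (hξ1 : cs.ξ ≤ 1) (hcB : 0 < cs.cB)
    {η τ n : ℝ} {j : ℕ} (hη : 0 ≤ η) (hj : 1 ≤ j) (hscale : c.L ^ j * η ≤ 1)
    (hξx : cs.ξ * (c.L ^ (j - 1) * η) = c.L⁻¹ * η) (hτ0 : 0 ≤ τ) (hτ1 : τ ≤ 1) (hn : n < c.α₃)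
    (heGc : ∀ A ∈ 𝓜.gc, expI cs.ξ A ∈ 𝓜.Gc)
    {Y : Region P i} (hXb : F.X.bonds ⊆ Y.bonds) (hXd : F.X.dpairs ⊆ Y.dpairs)
    (hXp : ∀ p ∈ F.X.plaqs, (⟨p.src, p.μ⟩ : PBond P i) ∈ Y.bonds ∧ (⟨p.src.shift p.μ, p.ν⟩ : PBond P i) ∈ Y.bonds ∧
      (⟨p.src.shift p.ν, p.μ⟩ : PBond P i) ∈ Y.bonds ∧ (⟨p.src, p.ν⟩ : PBond P i) ∈ Y.bonds ∧
      (p.src, p.μ, p.ν) ∈ Y.dpairs ∧ (p.src, p.ν, p.μ) ∈ Y.dpairs)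
    {H K A J : PBond P i → 𝔸} {ℓ : Plaq P i → 𝔸}
    (hKgc : ∀ b ∈ F.X.bonds, K b ∈ 𝓜.gc) (hAgc : ∀ b ∈ F.X.bonds, A b ∈ 𝓜.gc) (hJgc : ∀ b ∈ F.X.bonds, J b ∈ 𝓜.gc)
    (h41 : ∀ p ∈ F.X.plaqs, ‖((plaq (fun b => expI cs.ξ (H b)) p : 𝔸ˣ) : 𝔸) - 1‖ <
      Real.exp (c.B₃ ^ 2 * c.O₁ * c.M * c.α₀) * Real.exp (c.B₃ * c.O₁ * c.M * c.α₀) *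
      Real.exp (c.B₃ * c.O₁ * c.M * c.α₀) * Real.exp (c.O₁ * c.M * c.α₁) *
      ((1 + 2 * c.β) * c.α₀ * (c.L⁻¹ * η) ^ 2))
    (hH : ∀ b ∈ Y.bonds, ‖H b‖ < c.B₃ ^ 2 * c.O₁ * c.M * c.α₀ * (c.L ^ (j - 1) * η))
    (h45 : ∀ p ∈ F.X.plaqs, ‖(cs.ξ : ℂ)⁻¹ • (H ⟨p.src, p.μ⟩ + H ⟨p.src.shift p.μ, p.ν⟩ - H ⟨p.src.shift p.ν, p.μ⟩ -
      H ⟨p.src, p.ν⟩) - ℓ p‖ < c.B₃ * (c.B₃ * c.O₁ * c.M * c.α₀ * (c.L ^ (j - 1) * η)) ^ 2)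
    (hK : ∀ b ∈ Y.bonds, ‖K b‖ < c.B₃ ^ 2 * c.O₁ * c.M * c.α₀ * (c.L ^ (j - 1) * η))
    (hK1 : ∀ q ∈ Y.dpairs, ‖grad cs.ξ q.2.1 (fun y => K ⟨y, q.2.2⟩) q.1‖ < c.B₃ ^ 2 * c.O₁ * c.M * c.α₀ * (c.L ^ (j - 1) * η))
    (h45τ : ∀ p ∈ F.X.plaqs, ‖(cs.ξ : ℂ)⁻¹ • (K ⟨p.src, p.μ⟩ + K ⟨p.src.shift p.μ, p.ν⟩ - K ⟨p.src.shift p.ν, p.μ⟩ -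
      K ⟨p.src, p.ν⟩) - (τ : ℂ) • ℓ p‖ < c.B₃ * (c.B₃ * c.O₁ * c.M * c.α₀ * (c.L ^ (j - 1) * η)) ^ 2)
    (hA : ∀ b ∈ Y.bonds, ‖A b‖ ≤ c.B₃ * n)
    (hdA : ∀ q ∈ Y.dpairs, ‖grad cs.ξ q.2.1 (fun y => A ⟨y, q.2.2⟩) q.1‖ ≤ c.B₃ * n)
    (hJ : ∀ b ∈ F.X.bonds, ‖J b‖ < c.α₀)
    (hIV : CondIV F.bg F.X₂ cs c.α₀ (fun b => expI cs.ξ (K b + A b))) (hIV₁ : CondIV F.bg F.X₂ cs c.α₀ (1 : PBond P i → 𝔸ˣ)) :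
    (⟨fun b => expI cs.ξ (K b + A b), J⟩ : FieldPair P i 𝔸ˣ 𝔸) ∈ space' 𝓜 F cs c.α₀ c.α₁ := by
  obtain ⟨hGc, hgc, U, A', hf, h1, h2, h3⟩ := satisfiesI_III_lemma4 𝓜 c hR hB hY hα₁ hξ hξ1 hcB hη hj hscale hξx hτ0 hτ1 hn
    heGc hXb hXd hXp hKgc hAgc hJgc h41 hH h45 hK hK1 h45τ hA hdA hJ
  -- the witnesses of `satisfiesI_III_lemma4` are `U = 1`, `A′ = 𝐊 + 𝐀`; rebuild `Satisfies` with them and the (iv) data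
  have hR' := hR
  unfold B12Sec2to5.Lemma4Restrictions at hR'
  obtain ⟨hα₀, _, _, _, _, _, _, hL1, hres9, _, _, hres12, _, _⟩ := hR'
  have hB0 : 0 ≤ c.B₃ := by linarith
  have hY0 : 0 ≤ c.B₃ ^ 2 * c.O₁ * c.M * c.α₀ := by nlinarith
  have hx1 := scale_le_one hL1 hη hj hscale
  refine mem_space_of_satisfies ⟨hGc, hgc, 1, fun b => K b + A b, factors_expI_one cs _, condI_one F hξ.ne' hcB hα₀,
    condII_one 𝓜 (fun b hb => 𝓜.gc.add_mem (hKgc b hb) (hAgc b hb)) (fun b hb => ?_) (fun q hq => ?_), h3, hIV, hIV₁⟩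
  · exact norm_add_lt_alpha1 hx1 hB0 hY0 hres9 hres12 (hK b (hXb hb)) hn (hA b (hXb hb))
  · exact norm_grad_add_lt_alpha1 cs.ξ q.2.1 q.1 hx1 hB0 hY0 hres9 hres12 (hK1 q (hXd hq)) hn (hdA q (hXd hq))

/-! ## The printed pair `(exp iξ𝐇_j, D^{ξ*}_{exp iξ𝐇_j}ξ⁻²π Im ∂ exp iξ𝐇_j)` of p. 278: the substitution (1.9) with the current (1.8) -/

/-- **Lemma 4 for the printed pair with the concrete current (1.8).**  p. 278: «the condition (iv) is a consequence of the condition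
(iii) … for the pair of configurations exp iξ𝐇_j(…), D^{ξ*}_{exp iξ𝐇_j(…)}ξ⁻²π Im ∂ exp iξ𝐇_j(…)» — i.e. the pair is
`(𝐔, J(𝐔)) = B12Eq18Current.ofBackground π ξ 𝐔`, `𝐔 = exp iξ(𝐊 + 𝐀₂)`.  Under the hypotheses of `satisfiesI_III_lemma4` with the
J-half stated for `J(𝐔) = B12Eq18Current.current π ξ 𝐔` on `X`, and with `π` taking values in `𝔤ᶜ`, `𝔤ᶜ` stable under `Ad(Gᶜ)` and
`𝐊`, `𝐀₂` `𝔤ᶜ`-valued on all bonds (so that `𝐔` is `Gᶜ`-valued and `J(𝐔)` is `𝔤ᶜ`-valued, `B12Eq18Current.current_mem_gc`), the pair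
`(𝐔, J(𝐔))` satisfies (i)–(iii) of `U^c_j(X, α₀, α₁)`. [cite: Balaban1987RG1, Lemma 4 (3.53) p.280 with (1.8)-(1.9) p.261] -/
theorem ofBackground_satisfiesI_III_lemma4 (c : B12Sec2to5.Lemma4Consts) (hR : B12Sec2to5.Lemma4Restrictions c)
    (hB : 1 ≤ c.B₃) (hY : 1 ≤ c.B₃ ^ 2 * c.O₁ * c.M) (hα₁ : 16 * (c.O₁ * c.M * c.α₁) ≤ c.β)
    {F : Frame P i 𝔸} {cs : StepConsts} (hξ : 0 < cs.ξ) (hξ1 : cs.ξ ≤ 1) (hcB : 0 < cs.cB)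
    {η τ n : ℝ} {j : ℕ} (hη : 0 ≤ η) (hj : 1 ≤ j) (hscale : c.L ^ j * η ≤ 1)
    (hξx : cs.ξ * (c.L ^ (j - 1) * η) = c.L⁻¹ * η) (hτ0 : 0 ≤ τ) (hτ1 : τ ≤ 1) (hn : n < c.α₃)
    (heGc : ∀ A ∈ 𝓜.gc, expI cs.ξ A ∈ 𝓜.Gc) (π : 𝔸 →ₗ[ℂ] 𝔸) (hπ : ∀ X, π X ∈ 𝓜.gc)
    (hgc : ∀ g ∈ 𝓜.Gc, ∀ X ∈ 𝓜.gc, B9Eq39Adjoint.R g X ∈ 𝓜.gc)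
    {Y : Region P i} (hXb : F.X.bonds ⊆ Y.bonds) (hXd : F.X.dpairs ⊆ Y.dpairs)
    (hXp : ∀ p ∈ F.X.plaqs, (⟨p.src, p.μ⟩ : PBond P i) ∈ Y.bonds ∧ (⟨p.src.shift p.μ, p.ν⟩ : PBond P i) ∈ Y.bonds ∧
      (⟨p.src.shift p.ν, p.μ⟩ : PBond P i) ∈ Y.bonds ∧ (⟨p.src, p.ν⟩ : PBond P i) ∈ Y.bonds ∧
      (p.src, p.μ, p.ν) ∈ Y.dpairs ∧ (p.src, p.ν, p.μ) ∈ Y.dpairs)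
    {H K A : PBond P i → 𝔸} {ℓ : Plaq P i → 𝔸} (hKgc : ∀ b, K b ∈ 𝓜.gc) (hAgc : ∀ b, A b ∈ 𝓜.gc)
    (h41 : ∀ p ∈ F.X.plaqs, ‖((plaq (fun b => expI cs.ξ (H b)) p : 𝔸ˣ) : 𝔸) - 1‖ <
      Real.exp (c.B₃ ^ 2 * c.O₁ * c.M * c.α₀) * Real.exp (c.B₃ * c.O₁ * c.M * c.α₀) *
      Real.exp (c.B₃ * c.O₁ * c.M * c.α₀) * Real.exp (c.O₁ * c.M * c.α₁) *
      ((1 + 2 * c.β) * c.α₀ * (c.L⁻¹ * η) ^ 2))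
    (hH : ∀ b ∈ Y.bonds, ‖H b‖ < c.B₃ ^ 2 * c.O₁ * c.M * c.α₀ * (c.L ^ (j - 1) * η))
    (h45 : ∀ p ∈ F.X.plaqs, ‖(cs.ξ : ℂ)⁻¹ • (H ⟨p.src, p.μ⟩ + H ⟨p.src.shift p.μ, p.ν⟩ - H ⟨p.src.shift p.ν, p.μ⟩ -
      H ⟨p.src, p.ν⟩) - ℓ p‖ < c.B₃ * (c.B₃ * c.O₁ * c.M * c.α₀ * (c.L ^ (j - 1) * η)) ^ 2)
    (hK : ∀ b ∈ Y.bonds, ‖K b‖ < c.B₃ ^ 2 * c.O₁ * c.M * c.α₀ * (c.L ^ (j - 1) * η))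
    (hK1 : ∀ q ∈ Y.dpairs, ‖grad cs.ξ q.2.1 (fun y => K ⟨y, q.2.2⟩) q.1‖ < c.B₃ ^ 2 * c.O₁ * c.M * c.α₀ * (c.L ^ (j - 1) * η))
    (h45τ : ∀ p ∈ F.X.plaqs, ‖(cs.ξ : ℂ)⁻¹ • (K ⟨p.src, p.μ⟩ + K ⟨p.src.shift p.μ, p.ν⟩ - K ⟨p.src.shift p.ν, p.μ⟩ -
      K ⟨p.src, p.ν⟩) - (τ : ℂ) • ℓ p‖ < c.B₃ * (c.B₃ * c.O₁ * c.M * c.α₀ * (c.L ^ (j - 1) * η)) ^ 2)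
    (hA : ∀ b ∈ Y.bonds, ‖A b‖ ≤ c.B₃ * n)
    (hdA : ∀ q ∈ Y.dpairs, ‖grad cs.ξ q.2.1 (fun y => A ⟨y, q.2.2⟩) q.1‖ ≤ c.B₃ * n)
    (hJ : ∀ b ∈ F.X.bonds, ‖B12Eq18Current.current π cs.ξ (fun b => expI cs.ξ (K b + A b)) b‖ < c.α₀) :
    SatisfiesI_III 𝓜 F cs c.α₀ c.α₁ c.α₀ (B12Eq18Current.ofBackground π cs.ξ fun b => expI cs.ξ (K b + A b)) :=
  satisfiesI_III_lemma4 𝓜 c hR hB hY hα₁ hξ hξ1 hcB hη hj hscale hξx hτ0 hτ1 hn heGc hXb hXd hXp (fun b _ => hKgc b)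
    (fun b _ => hAgc b)
    (fun b _ => B12Eq18Current.current_mem_gc 𝓜 π hπ hgc cs.ξ (fun b' => heGc _ (𝓜.gc.add_mem (hKgc b') (hAgc b'))) b)
    h41 hH h45 hK hK1 h45τ hA hdA hJ

/-- **Lemma 4, membership of the printed pair**: under the hypotheses of `ofBackground_satisfiesI_III_lemma4` and condition (iv) for
`𝐔 = exp iξ(𝐊 + 𝐀₂)` and for `U = 1` («follows from the corresponding identity (3.38)», data-level), the pair `(𝐔, J(𝐔))` of (1.9)
lies in `U^c_j(X, α₀, α₁)`. [cite: Balaban1987RG1, Lemma 4 (3.53) p.280 with (1.8)-(1.9) p.261] -/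
theorem ofBackground_mem_space'_lemma4 (c : B12Sec2to5.Lemma4Consts) (hR : B12Sec2to5.Lemma4Restrictions c)
    (hB : 1 ≤ c.B₃) (hY : 1 ≤ c.B₃ ^ 2 * c.O₁ * c.M) (hα₁ : 16 * (c.O₁ * c.M * c.α₁) ≤ c.β)
    {F : Frame P i 𝔸} {cs : StepConsts} (hξ : 0 < cs.ξ) (hξ1 : cs.ξ ≤ 1) (hcB : 0 < cs.cB)
    {η τ n : ℝ} {j : ℕ} (hη : 0 ≤ η) (hj : 1 ≤ j) (hscale : c.L ^ j * η ≤ 1)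
    (hξx : cs.ξ * (c.L ^ (j - 1) * η) = c.L⁻¹ * η) (hτ0 : 0 ≤ τ) (hτ1 : τ ≤ 1) (hn : n < c.α₃)
    (heGc : ∀ A ∈ 𝓜.gc, expI cs.ξ A ∈ 𝓜.Gc) (π : 𝔸 →ₗ[ℂ] 𝔸) (hπ : ∀ X, π X ∈ 𝓜.gc)
    (hgc : ∀ g ∈ 𝓜.Gc, ∀ X ∈ 𝓜.gc, B9Eq39Adjoint.R g X ∈ 𝓜.gc)
    {Y : Region P i} (hXb : F.X.bonds ⊆ Y.bonds) (hXd : F.X.dpairs ⊆ Y.dpairs)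
    (hXp : ∀ p ∈ F.X.plaqs, (⟨p.src, p.μ⟩ : PBond P i) ∈ Y.bonds ∧ (⟨p.src.shift p.μ, p.ν⟩ : PBond P i) ∈ Y.bonds ∧
      (⟨p.src.shift p.ν, p.μ⟩ : PBond P i) ∈ Y.bonds ∧ (⟨p.src, p.ν⟩ : PBond P i) ∈ Y.bonds ∧
      (p.src, p.μ, p.ν) ∈ Y.dpairs ∧ (p.src, p.ν, p.μ) ∈ Y.dpairs)
    {H K A : PBond P i → 𝔸} {ℓ : Plaq P i → 𝔸} (hKgc : ∀ b, K b ∈ 𝓜.gc) (hAgc : ∀ b, A b ∈ 𝓜.gc)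
    (h41 : ∀ p ∈ F.X.plaqs, ‖((plaq (fun b => expI cs.ξ (H b)) p : 𝔸ˣ) : 𝔸) - 1‖ <
      Real.exp (c.B₃ ^ 2 * c.O₁ * c.M * c.α₀) * Real.exp (c.B₃ * c.O₁ * c.M * c.α₀) *
      Real.exp (c.B₃ * c.O₁ * c.M * c.α₀) * Real.exp (c.O₁ * c.M * c.α₁) *
      ((1 + 2 * c.β) * c.α₀ * (c.L⁻¹ * η) ^ 2))
    (hH : ∀ b ∈ Y.bonds, ‖H b‖ < c.B₃ ^ 2 * c.O₁ * c.M * c.α₀ * (c.L ^ (j - 1) * η))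
    (h45 : ∀ p ∈ F.X.plaqs, ‖(cs.ξ : ℂ)⁻¹ • (H ⟨p.src, p.μ⟩ + H ⟨p.src.shift p.μ, p.ν⟩ - H ⟨p.src.shift p.ν, p.μ⟩ -
      H ⟨p.src, p.ν⟩) - ℓ p‖ < c.B₃ * (c.B₃ * c.O₁ * c.M * c.α₀ * (c.L ^ (j - 1) * η)) ^ 2)
    (hK : ∀ b ∈ Y.bonds, ‖K b‖ < c.B₃ ^ 2 * c.O₁ * c.M * c.α₀ * (c.L ^ (j - 1) * η))
    (hK1 : ∀ q ∈ Y.dpairs, ‖grad cs.ξ q.2.1 (fun y => K ⟨y, q.2.2⟩) q.1‖ < c.B₃ ^ 2 * c.O₁ * c.M * c.α₀ * (c.L ^ (j - 1) * η))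
    (h45τ : ∀ p ∈ F.X.plaqs, ‖(cs.ξ : ℂ)⁻¹ • (K ⟨p.src, p.μ⟩ + K ⟨p.src.shift p.μ, p.ν⟩ - K ⟨p.src.shift p.ν, p.μ⟩ -
      K ⟨p.src, p.ν⟩) - (τ : ℂ) • ℓ p‖ < c.B₃ * (c.B₃ * c.O₁ * c.M * c.α₀ * (c.L ^ (j - 1) * η)) ^ 2)
    (hA : ∀ b ∈ Y.bonds, ‖A b‖ ≤ c.B₃ * n)
    (hdA : ∀ q ∈ Y.dpairs, ‖grad cs.ξ q.2.1 (fun y => A ⟨y, q.2.2⟩) q.1‖ ≤ c.B₃ * n)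
    (hJ : ∀ b ∈ F.X.bonds, ‖B12Eq18Current.current π cs.ξ (fun b => expI cs.ξ (K b + A b)) b‖ < c.α₀)
    (hIV : CondIV F.bg F.X₂ cs c.α₀ (fun b => expI cs.ξ (K b + A b))) (hIV₁ : CondIV F.bg F.X₂ cs c.α₀ (1 : PBond P i → 𝔸ˣ)) :
    B12Eq18Current.ofBackground π cs.ξ (fun b => expI cs.ξ (K b + A b)) ∈ space' 𝓜 F cs c.α₀ c.α₁ :=
  mem_space'_lemma4 𝓜 c hR hB hY hα₁ hξ hξ1 hcB hη hj hscale hξx hτ0 hτ1 hn heGc hXb hXd hXp (fun b _ => hKgc b)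
    (fun b _ => hAgc b)
    (fun b _ => B12Eq18Current.current_mem_gc 𝓜 π hπ hgc cs.ξ (fun b' => heGc _ (𝓜.gc.add_mem (hKgc b') (hAgc b'))) b)
    h41 hH h45 hK hK1 h45τ hA hdA hJ hIV hIV₁

end

end Literature.MathematicalPhysics.QuantumFieldTheory.Balaban1983to89.B12Lemma4Space
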